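import Mathlib.Analysis.Calculus.ImplicitContDiff
import Summits.QuantumFields.YangMills.Theorems.BalabanUVNodesN21ResponseRoadAtRegularSet

/-!
# N21 (NE7c) · THE MINIMISER'S RESPONSE TO THE BLOCK VARIABLES BY THE IMPLICIT FUNCTION THEOREM — the
# [14]-regularity rung of RADIAL TRANSVERSALITY (α): the differentiability half of the response road's NODE-O clause

Width seat `pub-ymgap-dag-n21-w7` (g0, second wave; dag-lead WIDTH-209 N21 piece 1 «START-LIST §n21 item 3 RADIAL
TRANSVERSALITY (lens near-miss N213 ∕ ROW S¹⁰ (α))»), node N21 = NE7c (NOT PRINTED in [Bałaban 1983–89], NOT proved),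
lane K3⁷ `SpineGivenEndpointR13SepCoPH` (stmt-QuantumFields-20544, `--kind proof --supports … --as helper`).
Consumes BY NAME n21-w3 f8 `…N21ResponseRoadAtRegularSet` (p598568 ✓: ★★★ `hRT_of_blockExpChart_regular`) and f7
`…N21ExponentialChartFieldStrength` (p597526 ✓: `isOpen_regularConfigs`, `isOpen_unitConfigs`,
`differentiableOn_plaqReading`); Mathlib's implicit function theorem (`HasStrictFDerivAt.implicitFunctionOfProdDomain`,
`ContDiffAt.implicitFunction`).  (dag-n21-w4 g0 reached §1 independently the same hour — unfiled kernel-checked twin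
`HOME/pub-ymgap-dag-n21-w4/lean/SolutionMapIFT.g0.draft.lean`, bus I.29160; credited.)  v1.1: PRIOR-ART paragraph corrected
(DOCSTRING-ONLY edition; declarations byte-identical to v1.0 p607125).

WHY.  The response road (n21-w3 files 1–12) discharges part 34's radial-transversality binder `hRT` from ONE
NODE-O-shaped clause: «for every fine plaquette `q` and exterior `z`, the plaquette reading `Ψ q z` of the MINIMISER, as
a function of the block's configuration `V : B → 𝔄`, is complex differentiable on the regular set
`Reg = {V | (∀ b, IsUnit (V b)) ∧ ∀ p ∈ plaqs, ‖∂V(p) − 1‖ < ε}` with `‖Ψ q z‖ ≤ S` there» (f8 `hΨd`, `hΨS`).  The lens'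
residual (α) is a statement about Bałaban's VARIATIONAL PROBLEM ([14] = CMP 102 (1985) 277: Thm 1 p. 279 existence and
(8) `|U_k(∂p) − 1| < B₃ε₁η²`; regularity via (190)-type Green's functions of [15]; [B12] = CMP 109 (1987) 249 Lemma 4
∕ (1.15)–(1.16): analytic dependence on the complex regular spaces).  THIS FILE types the [textbook] mechanism behind
the DIFFERENTIABILITY half of that clause for a GENERAL equation: a CONTINUOUS solution branch `U(V)` of `g(V, U) = 0`
whose fine partial `∂_U g` is invertible along the branch (the fine Hessian has a Green's function) IS, near every
point, Mathlib's implicit function (uniqueness clause), hence Fréchet differentiable — strict-derivative currency over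
any complete field, `C^n` currency (`ω` included) over `ℝ`∕`ℂ` — with `DU = −(∂_U g)⁻¹ ∘ ∂_V g` and `‖DU‖ ≤ ‖∂_V g‖∕γ`
under a coercivity letter `γ‖u‖ ≤ ‖∂_U g·u‖`.  Composed with f7's differentiable plaquette readings this PRODUCES f8's
`hΨd` for `Ψ q z V := ∂(U_z(V))(q) − 1`, so part 34's `hRT` holds through the exponential block chart with ONLY `hΨS`
(printed-shaped sup bound), the branch's continuity, the equation and the Hessian's invertibility displayed (★★★).  PRIOR
ART IN THE TREE (v1.1 correction — v1.0 under-cited it): the SAME identification mechanism, in the fixed-point form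
`Φ(p, X) = X − T p X` at class `ω` over `ℂ`, is lit-balaban's [folklore] `B11Claim309UAnalytic.analyticAt_fix` ∕
`continuousAt_fix` (reader r08 g9), applied there to Bałaban's Sect. E–G contraction scheme: `analyticOnNhd_solA` ∕ `analyticOnNhd_chartH(_pair)` — the (116) solution `solA` and the chart `𝓗`
are FRÉCHET-analytic in parameter-dependent data ([14] Prop. 9 «analytic function of B, and also of U») — and
`B11Eq183Differentiation.hasFDerivAt_solA180` ((182)–(188)); along complex lines `B11Prop6Scheme.solution_analytic`;
Lipschitz response `T4FixedPointResponse` §4–§5 ∕ `B11Eq120SolutionLipschitz`.  What §1–§3 add is the general-equation ∕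
strict ∕ `C^n` form with the explicit response and its letters; §4–§5 add the N21 junction (f8's `hΨd`, ★★★).

WHAT IS PROVED ([textbook] ∕ [bookkeeping]; 0 def, 0 sorry).
* §1 ★ `hasStrictFDerivAt_of_continuousAt_solution` (the branch lemma) · `partial_comp_branchDeriv_eq` (`∂_U g ∘ DU =
  −∂_V g`) · `differentiableOn_of_continuousOn_solution` ∕ `fderiv_eq_of_continuousOn_solution` (open set, along the branch).
* §2 ★′ `contDiffAt_of_continuousAt_solution` ∕ `contDiffOn_of_continuousOn_solution` (`RCLike 𝕜`, class `n ≠ 0`).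
* §3 letters: `opNorm_inverse_le_of_bound_below` (`‖(∂_U g)⁻¹‖ ≤ γ⁻¹`), `opNorm_branchDeriv_le` (`‖DU‖ ≤ γ⁻¹‖∂_V g‖`).
* §4 ★★ `psiClause_differentiableOn_of_criticalBranch` (readings of a continuous critical branch over an open set of block
  data) · ★★′ `psiClause_plaqReading_of_criticalBranch` = f8's `hΨd` VERBATIM (plaquette readings, unit-valued branch).
* §5 ★★★ `hRT_of_blockExpChart_regular_of_criticalBranch` = f8 ★★★ BY NAME with `hΨd` DISCHARGED by ★★′.
* §6 A2∕A6: `criticalBranch_scalar_witness` (★ on the nonlinear scalar branch `log (1 + x)` of `e^y − 1 − x = 0`, every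
  hypothesis discharged) · `criticalBranch_levelZero_witness` (★★′'s system inhabited in every `𝔄` by the branch `U = V`).

HONEST FRAMING.  [textbook] implicit-function calculus + composition BY NAME.  The identification of `g` with Bałaban's
block variational equation and of `U` with the minimiser ∕ background on `B12RegularSpaces111.space` ∕ `Node00.UbgOfRecord`
is a LOCATED dictionary, NOT asserted and NOT typed at NODE 00's objects; the branch's continuity, the fine Hessian's
invertibility and `hΨS` are HYPOTHESES; (α) itself (radial growth at rate `κ₀θ(1 − ρ)` on the shell) is NOT PRINTED and
NOT proved here; nothing of Bałaban's asserted; (M1) ∕ NE7c NOT PRINTED ∕ NOT proved; N21 NOT discharged; K3⁷ NOT claimed;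
counts unmoved (typed 28∕28 · discharged 5∕27, A 5∕28); count-neutral; one finite 𝕋⁴ at fixed ε — the Yang–Mills mass gap (Clay)
is NOT proved by any of this: R4 would close the conditional finite-𝕋⁴ rung `BalabanLadder.UV` only; nothing continuum ∕ ℝ⁴ ∕ OS.
-/

noncomputable section

open Filter Set Metric NormedSpace
open scoped Topology

namespace Summit.QuantumFields.YangMills.Theorems.N21MinimiserResponseImplicitFunction

/-! ## §1  A continuous solution branch through a non-degenerate point IS the implicit function: strict derivative -/

section Branch

variable {𝕜 : Type*} [NontriviallyNormedField 𝕜]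
  {E₁ : Type*} [NormedAddCommGroup E₁] [NormedSpace 𝕜 E₁] [CompleteSpace E₁]
  {E₂ : Type*} [NormedAddCommGroup E₂] [NormedSpace 𝕜 E₂] [CompleteSpace E₂]
  {F : Type*} [NormedAddCommGroup F] [NormedSpace 𝕜 F] [CompleteSpace F]

/-- ★ **A CONTINUOUS SOLUTION BRANCH IS THE IMPLICIT FUNCTION.**  Let `g : E₁ × E₂ → F` be strictly differentiable
at `(x₀, ψ x₀)` with derivative `g'` whose partial `g' ∘ inr : E₂ →L F` is invertible (the fine Hessian has a
Green's function), and let `ψ : E₁ → E₂` be ANY map continuous at `x₀` solving `g (x, ψ x) = g (x₀, ψ x₀)` for `x`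
near `x₀`.  Then `ψ` is strictly differentiable at `x₀` with derivative `−(g' ∘ inr)⁻¹ ∘ (g' ∘ inl)`: near `x₀` the
branch coincides with Mathlib's implicit function (uniqueness clause of the implicit function theorem). [textbook] -/
theorem hasStrictFDerivAt_of_continuousAt_solution {g : E₁ × E₂ → F} {g' : E₁ × E₂ →L[𝕜] F} {ψ : E₁ → E₂}
    {x₀ : E₁} (hg : HasStrictFDerivAt g g' (x₀, ψ x₀))
    (hinv : (g' ∘L ContinuousLinearMap.inr 𝕜 E₁ E₂).IsInvertible) (hψ : ContinuousAt ψ x₀)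
    (hsol : ∀ᶠ x in 𝓝 x₀, g (x, ψ x) = g (x₀, ψ x₀)) :
    HasStrictFDerivAt ψ (-(g' ∘L ContinuousLinearMap.inr 𝕜 E₁ E₂).inverse ∘L
      (g' ∘L ContinuousLinearMap.inl 𝕜 E₁ E₂)) x₀ := by
  have hlift : Tendsto (fun x => (x, ψ x)) (𝓝 x₀) (𝓝 (x₀, ψ x₀)) :=
    (continuous_id.tendsto x₀).prodMk_nhds hψ
  have hiff := hlift.eventually (hg.eventually_apply_eq_iff_implicitFunctionOfProdDomain hinv)
  have heq : hg.implicitFunctionOfProdDomain hinv =ᶠ[𝓝 x₀] ψ := by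
    filter_upwards [hiff, hsol] with x hx hs
    exact hx.mp hs
  exact (hg.hasStrictFDerivAt_implicitFunctionOfProdDomain hinv).congr_of_eventuallyEq heq

omit [CompleteSpace E₁] [CompleteSpace E₂] [CompleteSpace F] in
/-- **THE RESPONSE EQUATION**: the derivative `D` of the branch solves the linearised equation
`(g' ∘ inr) ∘ D = −(g' ∘ inl)` — i.e. `∂_U g · DU = −∂_V g` (differentiate `g(x, ψ x) = const`). [textbook] -/
theorem partial_comp_branchDeriv_eq {g' : E₁ × E₂ →L[𝕜] F}
    (hinv : (g' ∘L ContinuousLinearMap.inr 𝕜 E₁ E₂).IsInvertible) :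
    (g' ∘L ContinuousLinearMap.inr 𝕜 E₁ E₂) ∘L (-(g' ∘L ContinuousLinearMap.inr 𝕜 E₁ E₂).inverse ∘L
      (g' ∘L ContinuousLinearMap.inl 𝕜 E₁ E₂)) = -(g' ∘L ContinuousLinearMap.inl 𝕜 E₁ E₂) := by
  rw [ContinuousLinearMap.comp_neg, ← ContinuousLinearMap.comp_assoc, hinv.self_comp_inverse,
    ContinuousLinearMap.id_comp]

/-- On an OPEN set `D`: a solution branch continuous on `D`, with the equation strictly differentiable and its fine
partial invertible at every point of the branch over `D`, is differentiable on `D` (★ at every point). [textbook] -/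
theorem differentiableOn_of_continuousOn_solution {g : E₁ × E₂ → F} {g' : E₁ → E₁ × E₂ →L[𝕜] F} {ψ : E₁ → E₂}
    {D : Set E₁} (hD : IsOpen D) (hψ : ContinuousOn ψ D) (c : F) (hsol : ∀ x ∈ D, g (x, ψ x) = c)
    (hg : ∀ x ∈ D, HasStrictFDerivAt g (g' x) (x, ψ x))
    (hinv : ∀ x ∈ D, (g' x ∘L ContinuousLinearMap.inr 𝕜 E₁ E₂).IsInvertible) :
    DifferentiableOn 𝕜 ψ D := by
  intro x₀ hx₀
  have hnhds : D ∈ 𝓝 x₀ := hD.mem_nhds hx₀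
  have hsol' : ∀ᶠ x in 𝓝 x₀, g (x, ψ x) = g (x₀, ψ x₀) := by
    filter_upwards [hnhds] with x hx
    rw [hsol x hx, hsol x₀ hx₀]
  exact (hasStrictFDerivAt_of_continuousAt_solution (hg x₀ hx₀) (hinv x₀ hx₀) (hψ.continuousAt hnhds)
    hsol').hasFDerivAt.differentiableAt.differentiableWithinAt

/-- … with the derivative formula on `D`. [textbook] -/
theorem fderiv_eq_of_continuousOn_solution {g : E₁ × E₂ → F} {g' : E₁ → E₁ × E₂ →L[𝕜] F} {ψ : E₁ → E₂}
    {D : Set E₁} (hD : IsOpen D) (hψ : ContinuousOn ψ D) (c : F) (hsol : ∀ x ∈ D, g (x, ψ x) = c)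
    (hg : ∀ x ∈ D, HasStrictFDerivAt g (g' x) (x, ψ x))
    (hinv : ∀ x ∈ D, (g' x ∘L ContinuousLinearMap.inr 𝕜 E₁ E₂).IsInvertible) {x₀ : E₁} (hx₀ : x₀ ∈ D) :
    fderiv 𝕜 ψ x₀ = -(g' x₀ ∘L ContinuousLinearMap.inr 𝕜 E₁ E₂).inverse ∘L
      (g' x₀ ∘L ContinuousLinearMap.inl 𝕜 E₁ E₂) := by
  have hnhds : D ∈ 𝓝 x₀ := hD.mem_nhds hx₀
  have hsol' : ∀ᶠ x in 𝓝 x₀, g (x, ψ x) = g (x₀, ψ x₀) := by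
    filter_upwards [hnhds] with x hx
    rw [hsol x hx, hsol x₀ hx₀]
  exact (hasStrictFDerivAt_of_continuousAt_solution (hg x₀ hx₀) (hinv x₀ hx₀) (hψ.continuousAt hnhds)
    hsol').hasFDerivAt.fderiv

end Branch

/-! ## §2  The class is inherited: `C^n` equation ⇒ `C^n` branch (`n ≠ 0`, analytic class `ω` included) -/

section Smooth

variable {𝕜 : Type*} [RCLike 𝕜]
  {E₁ : Type*} [NormedAddCommGroup E₁] [NormedSpace 𝕜 E₁] [CompleteSpace E₁]
  {E₂ : Type*} [NormedAddCommGroup E₂] [NormedSpace 𝕜 E₂] [CompleteSpace E₂]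
  {F : Type*} [NormedAddCommGroup F] [NormedSpace 𝕜 F] [CompleteSpace F]

/-- ★′ **THE BRANCH INHERITS THE EQUATION'S CLASS**: if `g` is `C^n` at `(x₀, ψ x₀)` (`n ≠ 0`; `n = ω` is the
analytic class) with invertible fine partial `fderiv g ∘ inr`, then a solution branch `ψ` continuous at `x₀` is
`C^n` at `x₀`. [textbook] -/
theorem contDiffAt_of_continuousAt_solution {g : E₁ × E₂ → F} {ψ : E₁ → E₂} {x₀ : E₁} {n : WithTop ℕ∞}
    (hg : ContDiffAt 𝕜 n g (x₀, ψ x₀)) (hn : n ≠ 0)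
    (hinv : (fderiv 𝕜 g (x₀, ψ x₀) ∘L ContinuousLinearMap.inr 𝕜 E₁ E₂).IsInvertible) (hψ : ContinuousAt ψ x₀)
    (hsol : ∀ᶠ x in 𝓝 x₀, g (x, ψ x) = g (x₀, ψ x₀)) :
    ContDiffAt 𝕜 n ψ x₀ := by
  have hlift : Tendsto (fun x => (x, ψ x)) (𝓝 x₀) (𝓝 (x₀, ψ x₀)) :=
    (continuous_id.tendsto x₀).prodMk_nhds hψ
  have hiff := hlift.eventually (hg.eventually_apply_eq_iff_implicitFunction hn hinv)
  have heq : ψ =ᶠ[𝓝 x₀] hg.implicitFunction hn hinv := by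
    filter_upwards [hiff, hsol] with x hx hs
    exact (hx.mp hs).symm
  exact (hg.contDiffAt_implicitFunction hn hinv).congr_of_eventuallyEq heq

/-- On an OPEN set `D`: `C^n` along a continuous solution branch with invertible fine partials ⇒ `ContDiffOn`.
[textbook] -/
theorem contDiffOn_of_continuousOn_solution {g : E₁ × E₂ → F} {ψ : E₁ → E₂} {D : Set E₁} {n : WithTop ℕ∞}
    (hD : IsOpen D) (hψ : ContinuousOn ψ D) (c : F) (hsol : ∀ x ∈ D, g (x, ψ x) = c)
    (hg : ∀ x ∈ D, ContDiffAt 𝕜 n g (x, ψ x)) (hn : n ≠ 0)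
    (hinv : ∀ x ∈ D, (fderiv 𝕜 g (x, ψ x) ∘L ContinuousLinearMap.inr 𝕜 E₁ E₂).IsInvertible) :
    ContDiffOn 𝕜 n ψ D := by
  refine hD.contDiffOn_iff.mpr fun x₀ hx₀ => ?_
  have hnhds : D ∈ 𝓝 x₀ := hD.mem_nhds hx₀
  have hsol' : ∀ᶠ x in 𝓝 x₀, g (x, ψ x) = g (x₀, ψ x₀) := by
    filter_upwards [hnhds] with x hx
    rw [hsol x hx, hsol x₀ hx₀]
  exact contDiffAt_of_continuousAt_solution (hg x₀ hx₀) hn (hinv x₀ hx₀) (hψ.continuousAt hnhds) hsol'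

end Smooth

/-! ## §3  Letters: the Green's-function norm from a coercivity letter, and the size of the response derivative -/

section Letters

variable {𝕜 : Type*} [NontriviallyNormedField 𝕜]
  {E₁ : Type*} [NormedAddCommGroup E₁] [NormedSpace 𝕜 E₁]
  {E₂ : Type*} [NormedAddCommGroup E₂] [NormedSpace 𝕜 E₂]
  {F : Type*} [NormedAddCommGroup F] [NormedSpace 𝕜 F]

/-- **THE GREEN'S FUNCTION LETTER**: an invertible `T : E₂ →L F` bounded below by `γ‖y‖ ≤ ‖T y‖` (`γ > 0`, the
coercivity ∕ spectral-gap letter of the fine Hessian) has `‖T⁻¹‖ ≤ γ⁻¹`. [textbook] -/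
theorem opNorm_inverse_le_of_bound_below {T : E₂ →L[𝕜] F} (hT : T.IsInvertible) {γ : ℝ} (hγ : 0 < γ)
    (hbelow : ∀ y, γ * ‖y‖ ≤ ‖T y‖) : ‖T.inverse‖ ≤ γ⁻¹ := by
  refine ContinuousLinearMap.opNorm_le_bound _ (inv_nonneg.mpr hγ.le) fun z => ?_
  rw [inv_mul_eq_div, le_div_iff₀ hγ, mul_comm]
  simpa only [hT.self_apply_inverse] using hbelow (T.inverse z)

/-- **THE SIZE OF THE RESPONSE DERIVATIVE**: `‖−T⁻¹ ∘ S‖ ≤ γ⁻¹·‖S‖` — the branch's derivative is bounded by the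
Green's-function letter times the mixed partial `∂_V g`. [textbook] -/
theorem opNorm_branchDeriv_le {T : E₂ →L[𝕜] F} (hT : T.IsInvertible) {γ : ℝ} (hγ : 0 < γ)
    (hbelow : ∀ y, γ * ‖y‖ ≤ ‖T y‖) (S : E₁ →L[𝕜] F) : ‖-T.inverse ∘L S‖ ≤ γ⁻¹ * ‖S‖ := by
  rw [norm_neg]
  exact (ContinuousLinearMap.opNorm_comp_le _ _).trans
    (mul_le_mul_of_nonneg_right (opNorm_inverse_le_of_bound_below hT hγ hbelow) (norm_nonneg _))

end Letters

/-! ## §4  The response road's NODE-O clause (n21-w3 f8's `hΨd`) from a continuous critical branch -/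

section PsiClause

open Summit.QuantumFields.YangMills.Theorems.N21ExponentialChartFieldStrength
  (isOpen_unitConfigs isOpen_regularConfigs differentiableOn_plaqReading)

variable {𝔄 : Type*} [NormedRing 𝔄] [NormedAlgebra ℂ 𝔄] [CompleteSpace 𝔄]
  {B : Type*} [Fintype B] {Z P : Type*}
  {𝔉 : Type*} [NormedAddCommGroup 𝔉] [NormedSpace ℂ 𝔉] [CompleteSpace 𝔉]
  {𝔊 : Type*} [NormedAddCommGroup 𝔊] [NormedSpace ℂ 𝔊] [CompleteSpace 𝔊]
  {E : Type*} [NormedAddCommGroup E] [NormedSpace ℂ E]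

/-- ★★ **READINGS OF A CONTINUOUS CRITICAL BRANCH ARE DIFFERENTIABLE** (abstract form of f8's `hΨd`): over
an OPEN set `D` of block data, a fine-variable map `Umin z : (B → 𝔄) → 𝔉` CONTINUOUS on `D` and solving the block
variational equation `geq z (V, Umin z V) = 0` there ([14] Thm 1: the minimiser exists for regular data), with `geq z`
strictly ℂ-differentiable and its FINE PARTIAL INVERTIBLE along the branch ([15] (190): Green's functions of the fine
Hessian), and readings `read q` ℂ-differentiable at the branch's values ⇒ `V ↦ read q (Umin z V)` is ℂ-differentiable
on `D`.  The dictionary with Bałaban's objects is LOCATED, not asserted. [textbook ∘ bookkeeping] -/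
theorem psiClause_differentiableOn_of_criticalBranch {D : Set (B → 𝔄)} (hD : IsOpen D)
    (Umin : Z → (B → 𝔄) → 𝔉) (geq : Z → (B → 𝔄) × 𝔉 → 𝔊) (geq' : Z → (B → 𝔄) → ((B → 𝔄) × 𝔉 →L[ℂ] 𝔊))
    (hU : ∀ z, ContinuousOn (Umin z) D) (hsol : ∀ z, ∀ V ∈ D, geq z (V, Umin z V) = 0)
    (hg : ∀ z, ∀ V ∈ D, HasStrictFDerivAt (geq z) (geq' z V) (V, Umin z V))
    (hinv : ∀ z, ∀ V ∈ D, (geq' z V ∘L ContinuousLinearMap.inr ℂ (B → 𝔄) 𝔉).IsInvertible)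
    (read : P → 𝔉 → E) (hread : ∀ q z, ∀ V ∈ D, DifferentiableAt ℂ (read q) (Umin z V)) :
    ∀ q z, DifferentiableOn ℂ (fun V => read q (Umin z V)) D := by
  intro q z V hV
  have hUd := differentiableOn_of_continuousOn_solution hD (hU z) 0 (hsol z) (hg z) (hinv z)
  exact (hread q z V hV).comp_differentiableWithinAt V (hUd V hV)

/-- ★★′ **THE PLAQUETTE READING OF THE MINIMISER** (the response road's own statistic): when the fine variables are
bond variables `Bf → 𝔄` and the branch takes unit values on the regular set, the plaquette readings
`V ↦ ∂(Umin z V)(q) − 1` of the minimiser are ℂ-differentiable on the regular set — n21-w3 f8's `hΨd` for the cube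
sup of plaquette readings of the minimiser, its differentiability supplied by §1 and f7's
`differentiableOn_plaqReading`. [textbook ∘ bookkeeping] -/
theorem psiClause_plaqReading_of_criticalBranch {Bf : Type*} [Fintype Bf] (plaqs : Finset (B × B × B × B)) (ε : ℝ)
    (Umin : Z → (B → 𝔄) → (Bf → 𝔄)) (geq : Z → (B → 𝔄) × (Bf → 𝔄) → 𝔊)
    (geq' : Z → (B → 𝔄) → ((B → 𝔄) × (Bf → 𝔄) →L[ℂ] 𝔊))
    (hU : ∀ z, ContinuousOn (Umin z) {V : B → 𝔄 | (∀ b, IsUnit (V b)) ∧ ∀ p ∈ plaqs,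
      ‖V p.1 * V p.2.1 * Ring.inverse (V p.2.2.1) * Ring.inverse (V p.2.2.2) - 1‖ < ε})
    (hsol : ∀ z, ∀ V ∈ {V : B → 𝔄 | (∀ b, IsUnit (V b)) ∧ ∀ p ∈ plaqs,
      ‖V p.1 * V p.2.1 * Ring.inverse (V p.2.2.1) * Ring.inverse (V p.2.2.2) - 1‖ < ε}, geq z (V, Umin z V) = 0)
    (hg : ∀ z, ∀ V ∈ {V : B → 𝔄 | (∀ b, IsUnit (V b)) ∧ ∀ p ∈ plaqs,
      ‖V p.1 * V p.2.1 * Ring.inverse (V p.2.2.1) * Ring.inverse (V p.2.2.2) - 1‖ < ε},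
      HasStrictFDerivAt (geq z) (geq' z V) (V, Umin z V))
    (hinv : ∀ z, ∀ V ∈ {V : B → 𝔄 | (∀ b, IsUnit (V b)) ∧ ∀ p ∈ plaqs,
      ‖V p.1 * V p.2.1 * Ring.inverse (V p.2.2.1) * Ring.inverse (V p.2.2.2) - 1‖ < ε},
      (geq' z V ∘L ContinuousLinearMap.inr ℂ (B → 𝔄) (Bf → 𝔄)).IsInvertible)
    (hunit : ∀ z, ∀ V ∈ {V : B → 𝔄 | (∀ b, IsUnit (V b)) ∧ ∀ p ∈ plaqs,
      ‖V p.1 * V p.2.1 * Ring.inverse (V p.2.2.1) * Ring.inverse (V p.2.2.2) - 1‖ < ε}, ∀ b, IsUnit (Umin z V b)) :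
    ∀ (q : Bf × Bf × Bf × Bf) (z : Z), DifferentiableOn ℂ
      (fun V => Umin z V q.1 * Umin z V q.2.1 * Ring.inverse (Umin z V q.2.2.1) * Ring.inverse (Umin z V q.2.2.2) - 1)
      {V : B → 𝔄 | (∀ b, IsUnit (V b)) ∧ ∀ p ∈ plaqs,
        ‖V p.1 * V p.2.1 * Ring.inverse (V p.2.2.1) * Ring.inverse (V p.2.2.2) - 1‖ < ε} :=
  psiClause_differentiableOn_of_criticalBranch (isOpen_regularConfigs (𝔄 := 𝔄) plaqs ε) Umin geq geq' hU hsol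
    hg hinv (fun q (U : Bf → 𝔄) => U q.1 * U q.2.1 * Ring.inverse (U q.2.2.1) * Ring.inverse (U q.2.2.2) - 1)
    (fun q z V hV => ((differentiableOn_plaqReading (𝔄 := 𝔄) q).differentiableAt
      (isOpen_unitConfigs.mem_nhds (hunit z V hV))).sub_const 1)

end PsiClause

/-! ## §5  Junction BY NAME: part 34's `hRT` through the exponential block chart with `hΨd` DISCHARGED -/

section Junction

open Summit.QuantumFields.YangMills.Theorems.N21ResponseRoadAtRegularSet (hRT_of_blockExpChart_regular)

variable {𝔄 : Type*} [NormedRing 𝔄] [NormedAlgebra ℂ 𝔄] [CompleteSpace 𝔄] [NormOneClass 𝔄]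
  {κ B Bf : Type*} [Fintype κ] [Fintype B] [Fintype Bf] {Z : Type*}
  {𝔊 : Type*} [NormedAddCommGroup 𝔊] [NormedSpace ℂ 𝔊] [CompleteSpace 𝔊]

/-- ★★★ **PART 34's `hRT` FOR THE CUBE SUP OF PLAQUETTE READINGS OF THE MINIMISER THROUGH THE EXPONENTIAL BLOCK
CHART, THE `Ψ`-CLAUSE'S DIFFERENTIABILITY HALF DISCHARGED BY THE IMPLICIT FUNCTION THEOREM** — n21-w3 f8 ★★★
`hRT_of_blockExpChart_regular` BY NAME at `Ψ q z V := ∂(Umin z V)(q) − 1` with `hΨd := ★★′`; displayed instead: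
the branch's continuity, the equation along it, strict differentiability of the block variational equation, the
Green's functions of the fine Hessian (`hinv`), unit values, and the printed-shaped SUP BOUND `hΨS` ([14] Thm 1 (8):
`|U_k(∂p) − 1| < B₃ε₁η²` for `ε₁`-regular data — LOCATED, not asserted); every other binder of f8 verbatim.
Nothing of Bałaban's asserted; (α) itself NOT proved. [bookkeeping] -/
theorem hRT_of_blockExpChart_regular_of_criticalBranch [Nonempty Bf]
    (Xd : Z → κ → B → 𝔄) (V₀ : Z → B → 𝔄ˣ)
    {Ξ v v' r S δ ε ϱ R c₀ θ ρ κ₀ : ℝ} (hΞ0 : 0 ≤ Ξ) (hΞ : ∀ z b, ∑ a, ‖Xd z a b‖ ≤ Ξ) (hv0 : 0 ≤ v)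
    (hv : ∀ z b, ‖(V₀ z b : 𝔄)‖ ≤ v) (hv' : ∀ z b, ‖(↑(V₀ z b)⁻¹ : 𝔄)‖ ≤ v') (hr : 0 < r) (hS0 : 0 ≤ S)
    (hsmall : Ξ * Real.exp ((ϱ + r) * Ξ) * v * r * (v' * Real.exp (ϱ * Ξ)) ≤ 1 / 2)
    (plaqs : Finset (B × B × B × B))
    (hbudget : δ + max (Real.exp (ϱ * Ξ) * v + Ξ * Real.exp ((ϱ + r) * Ξ) * v * r)
        (2 * (v' * Real.exp (ϱ * Ξ))) ^ 3 * (2 + 4 * (v' * Real.exp (ϱ * Ξ)) ^ 2) *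
        (Ξ * Real.exp ((ϱ + r) * Ξ) * v * r) < ε)
    (Umin : Z → (B → 𝔄) → (Bf → 𝔄)) (geq : Z → (B → 𝔄) × (Bf → 𝔄) → 𝔊)
    (geq' : Z → (B → 𝔄) → ((B → 𝔄) × (Bf → 𝔄) →L[ℂ] 𝔊))
    (hU : ∀ z, ContinuousOn (Umin z) {V : B → 𝔄 | (∀ b, IsUnit (V b)) ∧ ∀ p ∈ plaqs,
      ‖V p.1 * V p.2.1 * Ring.inverse (V p.2.2.1) * Ring.inverse (V p.2.2.2) - 1‖ < ε})
    (hsol : ∀ z, ∀ V ∈ {V : B → 𝔄 | (∀ b, IsUnit (V b)) ∧ ∀ p ∈ plaqs,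
      ‖V p.1 * V p.2.1 * Ring.inverse (V p.2.2.1) * Ring.inverse (V p.2.2.2) - 1‖ < ε}, geq z (V, Umin z V) = 0)
    (hg : ∀ z, ∀ V ∈ {V : B → 𝔄 | (∀ b, IsUnit (V b)) ∧ ∀ p ∈ plaqs,
      ‖V p.1 * V p.2.1 * Ring.inverse (V p.2.2.1) * Ring.inverse (V p.2.2.2) - 1‖ < ε},
      HasStrictFDerivAt (geq z) (geq' z V) (V, Umin z V))
    (hinv : ∀ z, ∀ V ∈ {V : B → 𝔄 | (∀ b, IsUnit (V b)) ∧ ∀ p ∈ plaqs,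
      ‖V p.1 * V p.2.1 * Ring.inverse (V p.2.2.1) * Ring.inverse (V p.2.2.2) - 1‖ < ε},
      (geq' z V ∘L ContinuousLinearMap.inr ℂ (B → 𝔄) (Bf → 𝔄)).IsInvertible)
    (hunit : ∀ z, ∀ V ∈ {V : B → 𝔄 | (∀ b, IsUnit (V b)) ∧ ∀ p ∈ plaqs,
      ‖V p.1 * V p.2.1 * Ring.inverse (V p.2.2.1) * Ring.inverse (V p.2.2.2) - 1‖ < ε}, ∀ b, IsUnit (Umin z V b))
    (hΨS : ∀ (q : Bf × Bf × Bf × Bf) z, ∀ V ∈ {V : B → 𝔄 | (∀ b, IsUnit (V b)) ∧ ∀ p ∈ plaqs,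
      ‖V p.1 * V p.2.1 * Ring.inverse (V p.2.2.1) * Ring.inverse (V p.2.2.2) - 1‖ < ε},
      ‖Umin z V q.1 * Umin z V q.2.1 * Ring.inverse (Umin z V q.2.2.1) * Ring.inverse (Umin z V q.2.2.2) - 1‖ ≤ S)
    (K : Z → Set (κ → ℝ)) (hKϱ : ∀ z, ∀ x ∈ K z, ‖x‖ ≤ ϱ)
    (hreg : ∀ z, ∀ x ∈ K z, ∀ p ∈ plaqs,
      ‖exp (∑ a, (x a : ℂ) • Xd z a p.1) * (V₀ z p.1 : 𝔄) * (exp (∑ a, (x a : ℂ) • Xd z a p.2.1) * (V₀ z p.2.1 : 𝔄)) *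
        Ring.inverse (exp (∑ a, (x a : ℂ) • Xd z a p.2.2.1) * (V₀ z p.2.2.1 : 𝔄)) *
        Ring.inverse (exp (∑ a, (x a : ℂ) • Xd z a p.2.2.2) * (V₀ z p.2.2.2 : 𝔄)) - 1‖ ≤ δ)
    (c : Z → (κ → ℝ)) (hcK : ∀ z, c z ∈ K z) (hKR : ∀ z, ∀ w ∈ K z, ‖w - c z‖ ≤ R) (hRr : 2 * R < r)
    (hc₀ : ∀ (q : Bf × Bf × Bf × Bf) z,
      ‖Umin z (fun b => exp (∑ a, ((c z a : ℝ) : ℂ) • Xd z a b) * (V₀ z b : 𝔄)) q.1 *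
        Umin z (fun b => exp (∑ a, ((c z a : ℝ) : ℂ) • Xd z a b) * (V₀ z b : 𝔄)) q.2.1 *
        Ring.inverse (Umin z (fun b => exp (∑ a, ((c z a : ℝ) : ℂ) • Xd z a b) * (V₀ z b : 𝔄)) q.2.2.1) *
        Ring.inverse (Umin z (fun b => exp (∑ a, ((c z a : ℝ) : ℂ) • Xd z a b) * (V₀ z b : 𝔄)) q.2.2.2) - 1‖ ≤ c₀)
    {C : Set (Z × (κ → ℝ))} (hCK : ∀ p ∈ C, p.2 ∈ K p.1)
    (hnum : c₀ + 4 * (2 * (2 * S) / r ^ 2) * R ^ 2 ≤ (1 - κ₀) * (θ * (1 - ρ))) :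
    let Ψ : (Bf × Bf × Bf × Bf) → Z → (B → 𝔄) → 𝔄 := fun q z V =>
      Umin z V q.1 * Umin z V q.2.1 * Ring.inverse (Umin z V q.2.2.1) * Ring.inverse (Umin z V q.2.2.2) - 1
    ∀ p : Z × (κ → ℝ), θ * (1 - ρ) ≤ (⨆ q, ‖Ψ q p.1 (fun b => exp (∑ a, ((p.2 a : ℝ) : ℂ) • Xd p.1 a b) * (V₀ p.1 b : 𝔄))‖) → (⨆ q, ‖Ψ q p.1 (fun b => exp (∑ a, ((p.2 a : ℝ) : ℂ) • Xd p.1 a b) * (V₀ p.1 b : 𝔄))‖) < θ → p ∈ C → ∀ s : ℝ, 1 ≤ s →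
      θ * (1 - ρ) ≤ (⨆ q, ‖Ψ q p.1 (fun b => exp (∑ a, (((c p.1 + s • (p.2 - c p.1)) a : ℝ) : ℂ) • Xd p.1 a b) * (V₀ p.1 b : 𝔄))‖) → (⨆ q, ‖Ψ q p.1 (fun b => exp (∑ a, (((c p.1 + s • (p.2 - c p.1)) a : ℝ) : ℂ) • Xd p.1 a b) * (V₀ p.1 b : 𝔄))‖) < θ → (p.1, c p.1 + s • (p.2 - c p.1)) ∈ C →
        (⨆ q, ‖Ψ q p.1 (fun b => exp (∑ a, ((p.2 a : ℝ) : ℂ) • Xd p.1 a b) * (V₀ p.1 b : 𝔄))‖) + κ₀ * (θ * (1 - ρ)) * (s - 1) ≤ (⨆ q, ‖Ψ q p.1 (fun b => exp (∑ a, (((c p.1 + s • (p.2 - c p.1)) a : ℝ) : ℂ) • Xd p.1 a b) * (V₀ p.1 b : 𝔄))‖) := by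
  intro Ψ
  exact hRT_of_blockExpChart_regular Xd V₀ hΞ0 hΞ hv0 hv hv' hr hS0 hsmall plaqs hbudget Ψ
    (psiClause_plaqReading_of_criticalBranch plaqs ε Umin geq geq' hU hsol hg hinv hunit)
    (fun q z V hV => hΨS q z V hV) K hKϱ hreg c hcK hKR hRr (fun q z => hc₀ q z) hCK hnum

end Junction

/-! ## §6  A2∕A6: the binder systems are inhabited — a nonlinear scalar branch, and the level-0 branch in every `𝔄` -/

section Witness

/-- **A6 (★ is not vacuous, nonlinearly)**: the scalar equation `g(x, y) = e^y − 1 − x` with the continuous branch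
`ψ x = log (1 + x)` through `(0, 0)`: every hypothesis of ★ `hasStrictFDerivAt_of_continuousAt_solution` is
discharged in the kernel (strict derivative `(h₁, h₂) ↦ h₂ − h₁`, fine partial `= id` invertible, continuity of the
branch, the equation for `x > −1`), and the resulting derivative is `h ↦ h` (`= (log (1 + ·))′(0) · h`). [textbook] -/
theorem criticalBranch_scalar_witness :
    HasStrictFDerivAt (fun x : ℝ => Real.log (1 + x))
      (-((ContinuousLinearMap.snd ℝ ℝ ℝ - ContinuousLinearMap.fst ℝ ℝ ℝ) ∘L ContinuousLinearMap.inr ℝ ℝ ℝ).inverse ∘L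
        ((ContinuousLinearMap.snd ℝ ℝ ℝ - ContinuousLinearMap.fst ℝ ℝ ℝ) ∘L ContinuousLinearMap.inl ℝ ℝ ℝ)) 0 ∧
    ∀ h : ℝ, (-((ContinuousLinearMap.snd ℝ ℝ ℝ - ContinuousLinearMap.fst ℝ ℝ ℝ) ∘L
        ContinuousLinearMap.inr ℝ ℝ ℝ).inverse ∘L
        ((ContinuousLinearMap.snd ℝ ℝ ℝ - ContinuousLinearMap.fst ℝ ℝ ℝ) ∘L ContinuousLinearMap.inl ℝ ℝ ℝ)) h = h := by
  have hid : (ContinuousLinearMap.snd ℝ ℝ ℝ - ContinuousLinearMap.fst ℝ ℝ ℝ) ∘L ContinuousLinearMap.inr ℝ ℝ ℝ =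
      ContinuousLinearMap.id ℝ ℝ := by
    ext; simp
  have hinv : ((ContinuousLinearMap.snd ℝ ℝ ℝ - ContinuousLinearMap.fst ℝ ℝ ℝ) ∘L
      ContinuousLinearMap.inr ℝ ℝ ℝ).IsInvertible := by
    rw [hid]; exact ContinuousLinearMap.IsInvertible.of_inverse (g := ContinuousLinearMap.id ℝ ℝ) rfl rfl
  refine ⟨?_, fun h => by rw [hid]; simp⟩
  have hψ0 : Real.log (1 + 0) = 0 := by simp
  -- the equation map and its strict derivative at `(0, ψ 0) = (0, 0)`
  have hg : HasStrictFDerivAt (fun u : ℝ × ℝ => Real.exp u.2 - 1 - u.1)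
      (ContinuousLinearMap.snd ℝ ℝ ℝ - ContinuousLinearMap.fst ℝ ℝ ℝ) (0, Real.log (1 + 0)) := by
    rw [hψ0]
    have he : HasStrictFDerivAt (fun u : ℝ × ℝ => Real.exp u.2)
        ((ContinuousLinearMap.smulRight (1 : ℝ →L[ℝ] ℝ) (Real.exp 0)) ∘L ContinuousLinearMap.snd ℝ ℝ ℝ)
        ((0 : ℝ), (0 : ℝ)) :=
      (Real.hasStrictDerivAt_exp 0).hasStrictFDerivAt.comp ((0 : ℝ), (0 : ℝ)) hasStrictFDerivAt_snd
    refine ((he.sub_const 1).sub hasStrictFDerivAt_fst).congr_fderiv ?_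
    ext <;> simp
  refine hasStrictFDerivAt_of_continuousAt_solution (ψ := fun x : ℝ => Real.log (1 + x)) hg hinv ?_ ?_
  · exact (continuousAt_const.add continuousAt_id).log (by norm_num)
  · filter_upwards [eventually_gt_nhds (show (-1 : ℝ) < 0 by norm_num)] with x hx
    rw [hψ0, Real.exp_log (by linarith), Real.exp_zero]
    ring

variable {𝔄 : Type*} [NormedRing 𝔄] [NormedAlgebra ℂ 𝔄] [CompleteSpace 𝔄] {B : Type*} [Fintype B] {Z : Type*}

/-- **A2∕A6 (★★′'s system is jointly inhabited in every `𝔄`)** — the LEVEL-0 BRANCH: fine variables = block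
variables, `Umin z V = V`, equation `geq z (V, U) = U − V` (strict derivative `snd − fst`, fine partial `= id`),
readings = the plaquette variables of the data themselves: every hypothesis of ★★′ discharged, and its conclusion is
f8 §5's admissible reading.  (The genuine branch — Bałaban's minimiser on `B12RegularSpaces111.space` — is NODE O's
object; nothing about it is asserted here.) [bookkeeping] -/
theorem criticalBranch_levelZero_witness (plaqs : Finset (B × B × B × B)) (ε : ℝ) :
    ∀ (q : B × B × B × B) (_z : Z), DifferentiableOn ℂ
      (fun V : B → 𝔄 => V q.1 * V q.2.1 * Ring.inverse (V q.2.2.1) * Ring.inverse (V q.2.2.2) - 1)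
      {V : B → 𝔄 | (∀ b, IsUnit (V b)) ∧ ∀ p ∈ plaqs,
        ‖V p.1 * V p.2.1 * Ring.inverse (V p.2.2.1) * Ring.inverse (V p.2.2.2) - 1‖ < ε} :=
  psiClause_plaqReading_of_criticalBranch (Z := Z) plaqs ε (fun _ V => V) (fun _ u => u.2 - u.1)
    (fun _ _ => ContinuousLinearMap.snd ℂ (B → 𝔄) (B → 𝔄) - ContinuousLinearMap.fst ℂ (B → 𝔄) (B → 𝔄))
    (fun _ => continuousOn_id) (fun _ V _ => sub_self V)
    (fun _ V _ => ((ContinuousLinearMap.snd ℂ (B → 𝔄) (B → 𝔄)).hasStrictFDerivAt.sub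
      (ContinuousLinearMap.fst ℂ (B → 𝔄) (B → 𝔄)).hasStrictFDerivAt))
    (fun _ V _ => by
      have hid : (ContinuousLinearMap.snd ℂ (B → 𝔄) (B → 𝔄) - ContinuousLinearMap.fst ℂ (B → 𝔄) (B → 𝔄)) ∘L
          ContinuousLinearMap.inr ℂ (B → 𝔄) (B → 𝔄) = ContinuousLinearMap.id ℂ (B → 𝔄) := by
        ext; simp
      rw [hid]
      exact ContinuousLinearMap.IsInvertible.of_inverse (g := ContinuousLinearMap.id ℂ (B → 𝔄)) rfl rfl)
    (fun _ V hV => hV.1)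

end Witness

end Summit.QuantumFields.YangMills.Theorems.N21MinimiserResponseImplicitFunction
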